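import Mathlib
import Literature.NumberTheory.LFunctions.Zhang2022.Section10Range1321MidExact
import HarnessLib

/-!
# Zhang (2022) §10, `Θ₁(𝐚₁₃,𝐚₂₁)`, middle range (`Z22:§10.u043`, first line): scalar bookkeeping

Topic `Literature/NumberTheory/LFunctions/Zhang2022` (Landau–Siegel audit tree; verdict-neutral).
Y. Zhang, *Discrete mean estimates and the Landau–Siegel zero*, arXiv:2211.02515v1 (2022)
[Zhang2022LandauSiegel], §10 p. 58 — **an unrefereed manuscript under adjudication; nothing here
bears on its Theorems 1–2.** Pure real-arithmetic lemmas for the error budget of the edge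
`Sj1321Mid.eq1043a_of` (`Section10Range1321Mid`): the good-range and edge coefficients
(`coeff_good_le`, `coeff_edge_le`), the final comparison with `εα = επ𝓛⁻⁹` (`final_le`), and the
position facts of the middle range (`midRange_facts`: `1 ≤ P₁/n ≤ P^{0.004}`, `T < P₁/n < P`,
`n < PT⁻²` for `P^{0.5} ≤ n < P^{0.502}`, `𝓛 ≥ 3`).

## References

* Y. Zhang, arXiv:2211.02515v1 (2022), §10 p. 58. [cite: Zhang2022LandauSiegel, §10 p. 58]
-/

noncomputable section

open Complex Real Finset

namespace Literature.NumberTheory.LFunctions.Zhang2022.Sj1321Mid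

open Skeleton Typed.Sec10B

/-! ## §1. Scalar bookkeeping -/

/-- `P > 0`. [cite: Zhang2022LandauSiegel, §2 (2.6)] -/
private theorem bigP_pos₃ (D : ℕ) : 0 < bigP D := Real.exp_pos _

/-- The good-range coefficient: `e₁(e₂ + 146Λ′) + Ae₂ ≤ K_g 𝓛⁻¹²` with `e₁ = |C₁|𝓛⁻¹⁵`,
`e₂ = |C₂|𝓛⁻⁶`, `Λ′ = 𝓛³`, `A = 1000𝓛³/𝓛⁹`. [cite: Zhang2022LandauSiegel, §10 p. 58] -/
theorem coeff_good_le {L : ℝ} (hL : 1 ≤ L) (C₁ C₂ : ℝ) :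
    |C₁| * (L ^ 15)⁻¹ * (|C₂| * (L ^ 6)⁻¹ + 146 * L ^ 3) + 1000 * L ^ 3 / L ^ 9 * (|C₂| * (L ^ 6)⁻¹)
      ≤ (|C₁| * (|C₂| + 146) + 1000 * |C₂|) * (L ^ 12)⁻¹ := by
  have hL0 : 0 < L := by linarith
  have h1 : |C₁| * (L ^ 15)⁻¹ * (|C₂| * (L ^ 6)⁻¹) ≤ |C₁| * |C₂| * (L ^ 12)⁻¹ := by
    have hmono : (L ^ 21)⁻¹ ≤ (L ^ 12)⁻¹ :=
      inv_anti₀ (pow_pos hL0 12) (pow_le_pow_right₀ hL (by norm_num))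
    have heq : |C₁| * (L ^ 15)⁻¹ * (|C₂| * (L ^ 6)⁻¹) = |C₁| * |C₂| * (L ^ 21)⁻¹ := by
      field_simp
    rw [heq]
    exact mul_le_mul_of_nonneg_left hmono (by positivity)
  have h2 : |C₁| * (L ^ 15)⁻¹ * (146 * L ^ 3) = 146 * |C₁| * (L ^ 12)⁻¹ := by
    field_simp
  have h3 : 1000 * L ^ 3 / L ^ 9 * (|C₂| * (L ^ 6)⁻¹) = 1000 * |C₂| * (L ^ 12)⁻¹ := by
    field_simp
  nlinarith [h1, h2, h3]

/-- The edge coefficient: with `e₁ = |C₁|𝓛⁻⁷ + A`: `e₁(e₂ + 146Λ′) + Ae₂ ≤ K_e 𝓛⁻³`.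
[cite: Zhang2022LandauSiegel, §10 p. 58] -/
theorem coeff_edge_le {L : ℝ} (hL : 1 ≤ L) (C₁ C₂ : ℝ) :
    (|C₁| * (L ^ 7)⁻¹ + 1000 * L ^ 3 / L ^ 9) * (|C₂| * (L ^ 6)⁻¹ + 146 * L ^ 3) +
        1000 * L ^ 3 / L ^ 9 * (|C₂| * (L ^ 6)⁻¹)
      ≤ ((|C₁| + 1000) * (|C₂| + 146) + 1000 * |C₂|) * (L ^ 3)⁻¹ := by
  have hL0 : 0 < L := by linarith
  have hi : ∀ k : ℕ, 3 ≤ k → (L ^ k)⁻¹ ≤ (L ^ 3)⁻¹ := fun k hk =>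
    inv_anti₀ (pow_pos hL0 3) (pow_le_pow_right₀ hL hk)
  have t1 : |C₁| * (L ^ 7)⁻¹ * (|C₂| * (L ^ 6)⁻¹) ≤ |C₁| * |C₂| * (L ^ 3)⁻¹ := by
    have heq : |C₁| * (L ^ 7)⁻¹ * (|C₂| * (L ^ 6)⁻¹) = |C₁| * |C₂| * (L ^ 13)⁻¹ := by field_simp
    rw [heq]; exact mul_le_mul_of_nonneg_left (hi 13 (by norm_num)) (by positivity)
  have t2 : |C₁| * (L ^ 7)⁻¹ * (146 * L ^ 3) ≤ 146 * |C₁| * (L ^ 3)⁻¹ := by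
    have heq : |C₁| * (L ^ 7)⁻¹ * (146 * L ^ 3) = 146 * |C₁| * (L ^ 4)⁻¹ := by field_simp
    rw [heq]; exact mul_le_mul_of_nonneg_left (hi 4 (by norm_num)) (by positivity)
  have t3 : 1000 * L ^ 3 / L ^ 9 * (|C₂| * (L ^ 6)⁻¹) ≤ 1000 * |C₂| * (L ^ 3)⁻¹ := by
    have heq : 1000 * L ^ 3 / L ^ 9 * (|C₂| * (L ^ 6)⁻¹) = 1000 * |C₂| * (L ^ 12)⁻¹ := by
      field_simp
    rw [heq]; exact mul_le_mul_of_nonneg_left (hi 12 (by norm_num)) (by positivity)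
  have t4 : 1000 * L ^ 3 / L ^ 9 * (146 * L ^ 3) = 146000 * (L ^ 3)⁻¹ := by field_simp; ring
  nlinarith [t1, t2, t3, t4]

/-- The final scalar inequality: for `𝓛 ≥ 3` and `4e^{256}(K_g + K_e)/(επ) + 1 ≤ 𝓛`,
`(K_g𝓛⁻¹²/(0.504𝓛⁹))·e^{256}(2 + 𝓛⁹) + (K_e𝓛⁻³/(0.504𝓛⁹))·(2e^{256} + e^{256}(3 + 𝓛²)) ≤ ε·(π/𝓛⁹)`.
[cite: Zhang2022LandauSiegel, §10 p. 58] -/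
theorem final_le {L Kg Ke ε : ℝ} (hL : 3 ≤ L) (hKg : 0 ≤ Kg) (hKe : 0 ≤ Ke) (hε : 0 < ε)
    (hLK : 4 * Real.exp 256 * (Kg + Ke) / (ε * π) + 1 ≤ L) :
    Kg * (L ^ 12)⁻¹ / (0.504 * L ^ 9) * (Real.exp 256 * (2 + L ^ 9)) +
        Ke * (L ^ 3)⁻¹ / (0.504 * L ^ 9) * (2 * Real.exp 256 + Real.exp 256 * (3 + L ^ 2))
      ≤ ε * (π / L ^ 9) := by
  have hL0 : 0 < L := by linarith
  have hL1 : 1 ≤ L := by linarith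
  have e0 : 0 < Real.exp 256 := Real.exp_pos _
  have h9 : (3 : ℝ) ^ 9 ≤ L ^ 9 := pow_le_pow_left₀ (by norm_num) hL 9
  have h2 : (3 : ℝ) ^ 2 ≤ L ^ 2 := pow_le_pow_left₀ (by norm_num) hL 2
  -- first term ≤ 4e^{256}K_g/L/L⁹
  have A1 : Kg * (L ^ 12)⁻¹ / (0.504 * L ^ 9) * (Real.exp 256 * (2 + L ^ 9)) ≤
      4 * Real.exp 256 * Kg / L / L ^ 9 := by
    have heq : Kg * (L ^ 12)⁻¹ / (0.504 * L ^ 9) * (Real.exp 256 * (2 + L ^ 9)) =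
        (Real.exp 256 * Kg) * ((2 + L ^ 9) / (0.504 * L ^ 9 * L ^ 12)) := by
      field_simp
    have heq' : 4 * Real.exp 256 * Kg / L / L ^ 9 = (Real.exp 256 * Kg) * (4 / (L * L ^ 9)) := by
      field_simp
    rw [heq, heq']
    refine mul_le_mul_of_nonneg_left ?_ (by positivity)
    rw [div_le_div_iff₀ (by positivity) (by positivity)]
    have h19 : L ^ 10 ≤ L ^ 19 := pow_le_pow_right₀ hL1 (by norm_num)
    have h21 : 9 * L ^ 19 ≤ L ^ 21 := by
      calc 9 * L ^ 19 ≤ L ^ 2 * L ^ 19 := by nlinarith [pow_pos hL0 19]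
        _ = L ^ 21 := by ring
    nlinarith [pow_pos hL0 10]
  -- second term ≤ 4e^{256}K_e/L/L⁹
  have A2 : Ke * (L ^ 3)⁻¹ / (0.504 * L ^ 9) * (2 * Real.exp 256 + Real.exp 256 * (3 + L ^ 2)) ≤
      4 * Real.exp 256 * Ke / L / L ^ 9 := by
    have heq : Ke * (L ^ 3)⁻¹ / (0.504 * L ^ 9) * (2 * Real.exp 256 + Real.exp 256 * (3 + L ^ 2)) =
        (Real.exp 256 * Ke) * ((5 + L ^ 2) / (0.504 * L ^ 9 * L ^ 3)) := by
      field_simp; ring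
    have heq' : 4 * Real.exp 256 * Ke / L / L ^ 9 = (Real.exp 256 * Ke) * (4 / (L * L ^ 9)) := by
      field_simp
    rw [heq, heq']
    refine mul_le_mul_of_nonneg_left ?_ (by positivity)
    rw [div_le_div_iff₀ (by positivity) (by positivity)]
    have h12 : 9 * L ^ 10 ≤ L ^ 12 := by
      calc 9 * L ^ 10 ≤ L ^ 2 * L ^ 10 := by nlinarith [pow_pos hL0 10]
        _ = L ^ 12 := by ring
    nlinarith [pow_pos hL0 10]
  -- the threshold
  have hsum : 4 * Real.exp 256 * Kg / L / L ^ 9 + 4 * Real.exp 256 * Ke / L / L ^ 9 ≤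
      ε * (π / L ^ 9) := by
    have hM : 4 * Real.exp 256 * (Kg + Ke) ≤ ε * π * L := by
      have hεπ : 0 < ε * π := mul_pos hε Real.pi_pos
      have := (div_le_iff₀ hεπ).mp (by linarith : 4 * Real.exp 256 * (Kg + Ke) / (ε * π) ≤ L)
      linarith [this]
    have heq : 4 * Real.exp 256 * Kg / L / L ^ 9 + 4 * Real.exp 256 * Ke / L / L ^ 9 =
        (4 * Real.exp 256 * (Kg + Ke) / L) / L ^ 9 := by
      field_simp
    rw [heq, ← mul_div_assoc]
    refine div_le_div_of_nonneg_right ?_ (by positivity)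
    rwa [div_le_iff₀ hL0]
  linarith [A1, A2, hsum]

/-- Position facts for `n` in the middle range (`P^{0.5} ≤ n < P^{0.502}`, `𝓛 ≥ 3`): with
`x = P₁/n`, `1 ≤ x ≤ P^{0.004}`, `T < x < P`, and `n < PT⁻²`. [cite: Zhang2022LandauSiegel, §10 p. 58] -/
theorem midRange_facts {D : ℕ} (hL : 3 ≤ ell D) {n : ℕ} (hlo : bigP D ^ (0.5 : ℝ) ≤ (n : ℝ))
    (hhi : (n : ℝ) < bigP D ^ (0.502 : ℝ)) :
    1 ≤ Skeleton.P1 D / (n : ℝ) ∧ Skeleton.P1 D / (n : ℝ) ≤ bigP D ^ (0.004 : ℝ) ∧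
      bigT D < Skeleton.P1 D / (n : ℝ) ∧ Skeleton.P1 D / (n : ℝ) < bigP D ∧
      (n : ℝ) < bigP D / bigT D ^ 2 := by
  have hP : 0 < bigP D := bigP_pos₃ D
  have hP1 : 1 < bigP D := by
    have h9 : 0 < ell D ^ 9 := by have : 0 < ell D := by linarith
                                  positivity
    have := Real.add_one_lt_exp h9.ne'
    rw [bigP]; linarith
  have hP5 : 0 < bigP D ^ (0.5 : ℝ) := Real.rpow_pos_of_pos hP _
  have hn : 0 < (n : ℝ) := lt_of_lt_of_le hP5 hlo
  have hT0 : 0 < bigT D := Real.exp_pos _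
  have h504 : bigP D ^ (0.502 : ℝ) ≤ bigP D ^ (0.504 : ℝ) :=
    Real.rpow_le_rpow_of_exponent_le hP1.le (by norm_num)
  refine ⟨?_, ?_, ?_, ?_, ?_⟩
  · rw [le_div_iff₀ hn, one_mul, Skeleton.P1]; exact (hhi.le.trans h504)
  · rw [div_le_iff₀ hn, Skeleton.P1]
    calc bigP D ^ (0.504 : ℝ) = bigP D ^ (0.004 : ℝ) * bigP D ^ (0.5 : ℝ) := by
          rw [← Real.rpow_add hP]; norm_num
      _ ≤ bigP D ^ (0.004 : ℝ) * n := by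
          have : 0 ≤ bigP D ^ (0.004 : ℝ) := Real.rpow_nonneg hP.le _
          gcongr
  · rw [lt_div_iff₀ hn, Skeleton.P1]
    calc bigT D * n < bigT D * bigP D ^ (0.502 : ℝ) := by gcongr
      _ ≤ bigP D ^ (0.504 : ℝ) := bigT_mul_rpow_le hL
  · rw [div_lt_iff₀ hn, Skeleton.P1]
    have h1 : bigP D ^ (0.504 : ℝ) < bigP D := by
      conv_rhs => rw [← Real.rpow_one (bigP D)]
      exact Real.rpow_lt_rpow_of_exponent_lt hP1 (by norm_num)
    have hn1 : (1 : ℝ) ≤ n := by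
      have : (1 : ℝ) ≤ bigP D ^ (0.5 : ℝ) := Real.one_le_rpow hP1.le (by norm_num)
      linarith
    nlinarith
  · rw [lt_div_iff₀ (pow_pos hT0 2)]
    calc (n : ℝ) * bigT D ^ 2 < bigP D ^ (0.502 : ℝ) * bigT D ^ 2 := by gcongr
      _ ≤ bigP D := by rw [mul_comm]; exact bigT_sq_mul_rpow_le hL

end Literature.NumberTheory.LFunctions.Zhang2022.Sj1321Mid
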